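import Summits.KontsevichZagierPeriods.Zeta5Search.Barrier.ConeGammaCuspSlopeConvexityCriterion

/-!
# ζ(5) search — BARRIER: THE CONVEXITY TYPE OF THE CUSP SLOPE — differentiability, flat extrema, and the sign of the
# realised wall defects (file (2) of «CONVEXITY TYPE»)

HONEST FRAMING (cell `pub-zeta5`): systematic search; no irrationality claim unless kernel-certified. MODEL objects
under Brown–Zudilin's (28)+(30) accounting ([BZ22] = arXiv:2210.03391; (28) observed, not proved); nothing here is a
statement about `ζ(5)`, any `γ` of record, the cone's supremum (C2 OPEN) or the value / sign of the cusp slope, of a chamber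
weight, of a wall defect or of a one-sided derivative at a named direction (DATA of the cell); NO cancellation is quantified;
S-E / (TD_A) stay CONJECTURED; records in print UNMOVED. Prover P2 g44 (item «CONVEXITY TYPE», file (2); plan INBOX
2026-08-28). Sources: file (1) `ConeGammaCuspSlopeConvexityCriterion` (the local convexity / concavity criteria), P2 g43
`ConeGammaCuspSlopeTangentCone` / `…Walls` (differentiability and extremum criteria, `cuspSlope_eq_affine_near_of_differentiableAt`),
P2 g30 `ConeGammaCuspGermKink` (`greedy_sub_greedy_of_adjacent`).

SETTING as in file (1): `σ = cuspSlope a T`, rates `r_k = φ_k/h_k(a)`, `F` the canonical period pattern function, `W_k(δ₀)` the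
canonical chamber weights, `L_{δ₀}` the chamber functional of a generic reference `δ₀`.
* `convexOn_and_concaveOn_ball_of_affine` — an affine germ is convex and concave (bookkeeping);
* **`differentiableAt_cuspSlope_iff_convexOn_and_concaveOn`** — `σ` is differentiable at `δ` iff `σ` is convex on some
  neighbourhood of `δ` AND concave on some neighbourhood of `δ` (⇒: affine nearby, P2 g43; ⇐: by file (1) every refining
  functional is both `≤` and `≥` the one-sided derivative, so all refining references carry one functional — P2 g43's criterion);
* **`cuspSlope_eventually_const_of_convexOn_of_isLocalMax`** — if `σ` is convex near `δ` and `δ` is a local maximiser of `σ`, then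
  `σ` is CONSTANT on a neighbourhood of `δ` (every refining functional is `≤` the one-sided derivative `≤ 0` on all of `ℝ⁸`, so it
  vanishes); **`cuspSlope_eventually_const_of_concaveOn_of_isLocalMin`** — the twin. (P2 g43 had this at differentiability
  points; a convex kink cannot be a local maximum unless flat.)
* **`defect_nonneg_of_convexOn` / `defect_nonpos_of_concaveOn` — THE SIGN OF THE REALISED WALL DEFECTS**: if `σ` is convex
  (concave) near `δ` and `δ₀`, `δ₀'` are generic references refining `δ` whose orders differ by ONE ADJACENT TRANSPOSITION `(k, l)`,
  then with `S = {j : r_k(δ₀) < r_j(δ₀)}` their common prefix, **`F(S∪{k}) + F(S∪{l}) − F(S) − F(S∪{k,l}) ≥ 0` (`≤ 0`)** — the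
  submodular (supermodular) inequality of `F` AT THAT WALL (P2 g31 proved the converse from the inequality at ALL pairs of
  subsets; P2 g43: `= 0` where `σ` is differentiable). Which adjacent orders are realised near a named `δ` is DATA.
NOT here (honest): the convexity type, any value of `F`, `W_k`, `m_F` at a named direction (DATA); `Φ`, `γ`, C2, S-E, `ζ(5)`.
-/

noncomputable section

open Set Finset Filter
open scoped Topology

namespace Summit.KontsevichZagierPeriods.Zeta5Search.Barrier.ConeGamma

/-! ### Differentiable iff convex and concave nearby -/

/-- **An affine germ is convex and concave**: if `g(x) = g(δ) + L(x − δ)` on a ball, `L` linear, then `g` is both convex and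
concave on that ball (bookkeeping). -/
theorem convexOn_and_concaveOn_ball_of_affine {g : (Fin 8 → ℝ) → ℝ} {δ : Fin 8 → ℝ} {ε : ℝ}
    (L : (Fin 8 → ℝ) →L[ℝ] ℝ) (h : ∀ x ∈ Metric.ball δ ε, g x = g δ + L (x - δ)) :
    ConvexOn ℝ (Metric.ball δ ε) g ∧ ConcaveOn ℝ (Metric.ball δ ε) g := by
  have key : ∀ x ∈ Metric.ball δ ε, ∀ y ∈ Metric.ball δ ε, ∀ p q : ℝ, 0 ≤ p → 0 ≤ q → p + q = 1 →
      g (p • x + q • y) = p • g x + q • g y := by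
    intro x hx y hy p q hp hq hpq
    have hz : p • x + q • y ∈ Metric.ball δ ε := convex_ball δ ε hx hy hp hq hpq
    have e : p • x + q • y - δ = p • (x - δ) + q • (y - δ) := by
      ext i
      simp only [Pi.add_apply, Pi.smul_apply, Pi.sub_apply, smul_eq_mul]
      linear_combination (δ i) * hpq
    rw [h _ hz, h x hx, h y hy, e, map_add, map_smul, map_smul, smul_eq_mul, smul_eq_mul, smul_eq_mul, smul_eq_mul]
    linear_combination (-(g δ)) * hpq
  exact ⟨⟨convex_ball δ ε, fun x hx y hy p q hp hq hpq => (key x hx y hy p q hp hq hpq).le⟩,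
    ⟨convex_ball δ ε, fun x hx y hy p q hp hq hpq => (key x hx y hy p q hp hq hpq).ge⟩⟩

/-- **`σ` IS DIFFERENTIABLE AT `δ` IFF IT IS CONVEX NEAR `δ` AND CONCAVE NEAR `δ`.** All 28 forms of `a` positive, `T > 0` a
period. (⇒: `σ` is affine near a differentiability point, P2 g43. ⇐: by the criteria of file (1) every refining chamber functional
is both `≤` and `≥` the one-sided derivative functional on every direction, so any two generic references refining `δ` carry the
same functional — P2 g43's differentiability criterion.) So every NON-differentiability point of `σ` is a point where `σ` is of
strictly convex type, strictly concave type, or of neither type (a saddle kink). -/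
theorem differentiableAt_cuspSlope_iff_convexOn_and_concaveOn {a : Dir} (hpos : ∀ k, 0 < h28 a k) {T : ℝ} (hT : 0 < T)
    (hper : ∀ k : Fin 28, ∃ z : ℤ, T * h28 a k = z) (δ : Fin 8 → ℝ) :
    DifferentiableAt ℝ (cuspSlope a T) δ ↔
      (∃ U ∈ 𝓝 δ, ConvexOn ℝ U (cuspSlope a T)) ∧ ∃ U ∈ 𝓝 δ, ConcaveOn ℝ U (cuspSlope a T) := by
  classical
  obtain ⟨F, hF⟩ : ∃ F : Finset (Fin 28) → ℝ,
      ∀ A, F A = ∑ m ∈ Finset.range ((bkpts a T).card - 1), ((patternN a (bkpt a T m) A : ℤ) : ℝ) := ⟨_, fun _ => rfl⟩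
  constructor
  · intro hd
    obtain ⟨ε, hε, hball⟩ := Metric.mem_nhds_iff.mp (cuspSlope_eq_affine_near_of_differentiableAt hpos hT hper hF hd)
    have h := convexOn_and_concaveOn_ball_of_affine (fderiv ℝ (cuspSlope a T) δ) fun x hx => hball hx
    exact ⟨⟨Metric.ball δ ε, Metric.ball_mem_nhds δ hε, h.1⟩, ⟨Metric.ball δ ε, Metric.ball_mem_nhds δ hε, h.2⟩⟩
  · rintro ⟨hconv, hconc⟩
    rw [convexOn_cuspSlope_nhds_iff hpos hT hper hF δ] at hconv
    rw [concaveOn_cuspSlope_nhds_iff hpos hT hper hF δ] at hconc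
    refine (differentiableAt_cuspSlope_iff_greedy_eq hpos hT hper hF δ).mpr
      fun δ₀ δ₀' hgen hgen' href href' Δ => ?_
    obtain ⟨δ₁, hgen₁, hlex₁⟩ := exists_generic_refines_lex hpos δ Δ
    exact ((hconv Δ δ₁ δ₀ hgen₁ hgen hlex₁ href).antisymm (hconc Δ δ₁ δ₀ hgen₁ hgen hlex₁ href)).trans
      ((hconc Δ δ₁ δ₀' hgen₁ hgen' hlex₁ href').antisymm (hconv Δ δ₁ δ₀' hgen₁ hgen' hlex₁ href'))

/-! ### A locally convex `σ` with a local maximum is flat -/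

/-- The chamber functional of `−Δ` is minus that of `Δ`. -/
theorem greedy_neg_dir (a : Dir) (W : Fin 28 → ℝ) (Δ : Fin 8 → ℝ) :
    ∑ k, W k * (phiForm (-Δ) k / h28 a k) = -∑ k, W k * (phiForm Δ k / h28 a k) := by
  rw [← Finset.sum_neg_distrib]
  exact Finset.sum_congr rfl fun k _ => by rw [phiForm_neg]; ring

/-- **IF `σ` IS CONVEX NEAR A LOCAL MAXIMISER `δ`, EVERY REFINING CHAMBER FUNCTIONAL VANISHES.** All 28 forms of `a` positive,
`T > 0` a period, `F` the canonical period pattern function. If `σ` is convex on a neighbourhood of `δ` and `δ` is a local maximiser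
of `σ`, then `Σ_k W_k(δ₀')·φ_k(Δ)/h_k(a) = 0` for every generic `δ₀'` refining `δ` and EVERY `Δ` (it is `≤` the one-sided derivative,
which is `≤ 0` by P2 g43's extremum criterion, on `Δ` and on `−Δ`). -/
theorem greedy_eq_zero_of_convexOn_of_isLocalMax {a : Dir} (hpos : ∀ k, 0 < h28 a k) {T : ℝ} (hT : 0 < T)
    (hper : ∀ k : Fin 28, ∃ z : ℤ, T * h28 a k = z) {F : Finset (Fin 28) → ℝ}
    (hF : ∀ A, F A = ∑ m ∈ Finset.range ((bkpts a T).card - 1), ((patternN a (bkpt a T m) A : ℤ) : ℝ))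
    {δ : Fin 8 → ℝ} (hconv : ∃ U ∈ 𝓝 δ, ConvexOn ℝ U (cuspSlope a T)) (hmax : IsLocalMax (cuspSlope a T) δ)
    {δ₀' : Fin 8 → ℝ} (hgen' : ∀ k l : Fin 28, k ≠ l → phiForm δ₀' k / h28 a k ≠ phiForm δ₀' l / h28 a l)
    (href' : ∀ k l : Fin 28, phiForm δ k / h28 a k < phiForm δ l / h28 a l →
      phiForm δ₀' k / h28 a k < phiForm δ₀' l / h28 a l) (Δ : Fin 8 → ℝ) :
    ∑ k, (F (Finset.univ.filter fun l => phiForm δ₀' k / h28 a k ≤ phiForm δ₀' l / h28 a l) -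
        F (Finset.univ.filter fun l => phiForm δ₀' k / h28 a k < phiForm δ₀' l / h28 a l)) *
      (phiForm Δ k / h28 a k) = 0 := by
  rw [convexOn_cuspSlope_nhds_iff hpos hT hper hF δ] at hconv
  rw [isLocalMax_cuspSlope_iff hpos hT hper hF δ] at hmax
  have hle : ∀ Δ' : Fin 8 → ℝ,
      ∑ k, (F (Finset.univ.filter fun l => phiForm δ₀' k / h28 a k ≤ phiForm δ₀' l / h28 a l) -
          F (Finset.univ.filter fun l => phiForm δ₀' k / h28 a k < phiForm δ₀' l / h28 a l)) *
        (phiForm Δ' k / h28 a k) ≤ 0 := by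
    intro Δ'
    obtain ⟨δ₁, hgen₁, hlex₁⟩ := exists_generic_refines_lex hpos δ Δ'
    exact (hconv Δ' δ₁ δ₀' hgen₁ hgen' hlex₁ href').trans (hmax Δ' δ₁ hgen₁ hlex₁)
  have h1 := hle Δ
  have h2 := hle (-Δ)
  rw [greedy_neg_dir] at h2
  linarith

/-- **A LOCALLY CONVEX CUSP SLOPE WITH A LOCAL MAXIMUM AT `δ` IS CONSTANT NEAR `δ`.** All 28 forms of `a` positive, `T > 0` a
period. If `σ` is convex on some neighbourhood of `δ` and `IsLocalMax σ δ`, then `σ(δ') = σ(δ)` for all `δ'` near `δ` (the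
tangent cone is attained on a neighbourhood and every refining functional vanishes) — a kink of convex type is never a local
maximum; P2 g31's «submodular period pattern function and no ascent direction ⇒ cusp-free» is the case `δ = 0` under a
modularity hypothesis that IMPLIES convexity (file (3) makes the equivalence at the closed orbit explicit). -/
theorem cuspSlope_eventually_const_of_convexOn_of_isLocalMax {a : Dir} (hpos : ∀ k, 0 < h28 a k) {T : ℝ} (hT : 0 < T)
    (hper : ∀ k : Fin 28, ∃ z : ℤ, T * h28 a k = z) {δ : Fin 8 → ℝ}
    (hconv : ∃ U ∈ 𝓝 δ, ConvexOn ℝ U (cuspSlope a T)) (hmax : IsLocalMax (cuspSlope a T) δ) :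
    ∀ᶠ δ' in 𝓝 δ, cuspSlope a T δ' = cuspSlope a T δ := by
  classical
  obtain ⟨F, hF⟩ : ∃ F : Finset (Fin 28) → ℝ,
      ∀ A, F A = ∑ m ∈ Finset.range ((bkpts a T).card - 1), ((patternN a (bkpt a T m) A : ℤ) : ℝ) := ⟨_, fun _ => rfl⟩
  filter_upwards [cuspSlope_eq_add_lex_functional_eventually hpos hT hper hF δ] with δ' h
  obtain ⟨δ₁, hgen₁, hlex₁⟩ := exists_generic_refines_lex hpos δ (δ' - δ)
  rw [h δ₁ hgen₁ hlex₁, greedy_eq_zero_of_convexOn_of_isLocalMax hpos hT hper hF hconv hmax hgen₁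
    (fun k l hkl => hlex₁ k l (Or.inl hkl)) (δ' - δ), add_zero]

/-- **… and then `σ` is differentiable at `δ` with zero derivative.** -/
theorem hasFDerivAt_zero_of_convexOn_of_isLocalMax {a : Dir} (hpos : ∀ k, 0 < h28 a k) {T : ℝ} (hT : 0 < T)
    (hper : ∀ k : Fin 28, ∃ z : ℤ, T * h28 a k = z) {δ : Fin 8 → ℝ}
    (hconv : ∃ U ∈ 𝓝 δ, ConvexOn ℝ U (cuspSlope a T)) (hmax : IsLocalMax (cuspSlope a T) δ) :
    HasFDerivAt (cuspSlope a T) (0 : (Fin 8 → ℝ) →L[ℝ] ℝ) δ :=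
  (hasFDerivAt_const (cuspSlope a T δ) δ).congr_of_eventuallyEq
    (cuspSlope_eventually_const_of_convexOn_of_isLocalMax hpos hT hper hconv hmax)

/-- **IF `σ` IS CONCAVE NEAR A LOCAL MINIMISER `δ`, EVERY REFINING CHAMBER FUNCTIONAL VANISHES** (twin). -/
theorem greedy_eq_zero_of_concaveOn_of_isLocalMin {a : Dir} (hpos : ∀ k, 0 < h28 a k) {T : ℝ} (hT : 0 < T)
    (hper : ∀ k : Fin 28, ∃ z : ℤ, T * h28 a k = z) {F : Finset (Fin 28) → ℝ}
    (hF : ∀ A, F A = ∑ m ∈ Finset.range ((bkpts a T).card - 1), ((patternN a (bkpt a T m) A : ℤ) : ℝ))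
    {δ : Fin 8 → ℝ} (hconc : ∃ U ∈ 𝓝 δ, ConcaveOn ℝ U (cuspSlope a T)) (hmin : IsLocalMin (cuspSlope a T) δ)
    {δ₀' : Fin 8 → ℝ} (hgen' : ∀ k l : Fin 28, k ≠ l → phiForm δ₀' k / h28 a k ≠ phiForm δ₀' l / h28 a l)
    (href' : ∀ k l : Fin 28, phiForm δ k / h28 a k < phiForm δ l / h28 a l →
      phiForm δ₀' k / h28 a k < phiForm δ₀' l / h28 a l) (Δ : Fin 8 → ℝ) :
    ∑ k, (F (Finset.univ.filter fun l => phiForm δ₀' k / h28 a k ≤ phiForm δ₀' l / h28 a l) -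
        F (Finset.univ.filter fun l => phiForm δ₀' k / h28 a k < phiForm δ₀' l / h28 a l)) *
      (phiForm Δ k / h28 a k) = 0 := by
  rw [concaveOn_cuspSlope_nhds_iff hpos hT hper hF δ] at hconc
  rw [isLocalMin_cuspSlope_iff hpos hT hper hF δ] at hmin
  have hge : ∀ Δ' : Fin 8 → ℝ,
      0 ≤ ∑ k, (F (Finset.univ.filter fun l => phiForm δ₀' k / h28 a k ≤ phiForm δ₀' l / h28 a l) -
          F (Finset.univ.filter fun l => phiForm δ₀' k / h28 a k < phiForm δ₀' l / h28 a l)) *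
        (phiForm Δ' k / h28 a k) := by
    intro Δ'
    obtain ⟨δ₁, hgen₁, hlex₁⟩ := exists_generic_refines_lex hpos δ Δ'
    exact (hmin Δ' δ₁ hgen₁ hlex₁).trans (hconc Δ' δ₁ δ₀' hgen₁ hgen' hlex₁ href')
  have h1 := hge Δ
  have h2 := hge (-Δ)
  rw [greedy_neg_dir] at h2
  linarith

/-- **A LOCALLY CONCAVE CUSP SLOPE WITH A LOCAL MINIMUM AT `δ` IS CONSTANT NEAR `δ`** (twin). -/
theorem cuspSlope_eventually_const_of_concaveOn_of_isLocalMin {a : Dir} (hpos : ∀ k, 0 < h28 a k) {T : ℝ} (hT : 0 < T)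
    (hper : ∀ k : Fin 28, ∃ z : ℤ, T * h28 a k = z) {δ : Fin 8 → ℝ}
    (hconc : ∃ U ∈ 𝓝 δ, ConcaveOn ℝ U (cuspSlope a T)) (hmin : IsLocalMin (cuspSlope a T) δ) :
    ∀ᶠ δ' in 𝓝 δ, cuspSlope a T δ' = cuspSlope a T δ := by
  classical
  obtain ⟨F, hF⟩ : ∃ F : Finset (Fin 28) → ℝ,
      ∀ A, F A = ∑ m ∈ Finset.range ((bkpts a T).card - 1), ((patternN a (bkpt a T m) A : ℤ) : ℝ) := ⟨_, fun _ => rfl⟩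
  filter_upwards [cuspSlope_eq_add_lex_functional_eventually hpos hT hper hF δ] with δ' h
  obtain ⟨δ₁, hgen₁, hlex₁⟩ := exists_generic_refines_lex hpos δ (δ' - δ)
  rw [h δ₁ hgen₁ hlex₁, greedy_eq_zero_of_concaveOn_of_isLocalMin hpos hT hper hF hconc hmin hgen₁
    (fun k l hkl => hlex₁ k l (Or.inl hkl)) (δ' - δ), add_zero]

/-! ### The sign of the realised wall defects -/

/-- Two references refining `δ` that order `k, l` differently: `k` and `l` are TIED at `δ`. -/
theorem rates_eq_of_refines_of_opposite {a : Dir} {δ δ₀ δ₀' : Fin 8 → ℝ}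
    (href : ∀ k l : Fin 28, phiForm δ k / h28 a k < phiForm δ l / h28 a l →
      phiForm δ₀ k / h28 a k < phiForm δ₀ l / h28 a l)
    (href' : ∀ k l : Fin 28, phiForm δ k / h28 a k < phiForm δ l / h28 a l →
      phiForm δ₀' k / h28 a k < phiForm δ₀' l / h28 a l)
    {k l : Fin 28} (hρ : phiForm δ₀ l / h28 a l < phiForm δ₀ k / h28 a k)
    (hρ' : phiForm δ₀' k / h28 a k < phiForm δ₀' l / h28 a l) :
    phiForm δ k / h28 a k = phiForm δ l / h28 a l := by
  rcases lt_trichotomy (phiForm δ k / h28 a k) (phiForm δ l / h28 a l) with h1 | h1 | h1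
  · exact absurd (href k l h1) (lt_asymm hρ)
  · exact h1
  · exact absurd (href' l k h1) (lt_asymm hρ')

/-- **WHERE `σ` IS LOCALLY CONVEX, EVERY REALISED ADJACENT WALL DEFECT IS `≥ 0`** (the submodular inequality AT THAT WALL). All 28
forms of `a` positive, `T > 0` a period, `F` the canonical period pattern function; `σ` convex on a neighbourhood of `δ`; `δ₀`,
`δ₀'` generic references refining `δ` whose rate orders differ exactly by the adjacent transposition of `k ≠ l` (`r_l(δ₀) < r_k(δ₀)`
with no form strictly between, `r_k(δ₀') < r_l(δ₀')`, every other form on the same side of the pair and in the same relative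
order for both). Then with `S = {j : r_k(δ₀) < r_j(δ₀)}`: **`0 ≤ F(S∪{k}) + F(S∪{l}) − F(S) − F(S∪{k,l})`** (file (1) at the
direction `δ₀ − δ`: `L_{δ₀'} ≤ L_{δ₀}` there; P2 g30: the difference is the defect times `r_l(δ₀) − r_k(δ₀) < 0`). -/
theorem defect_nonneg_of_convexOn {a : Dir} (hpos : ∀ k, 0 < h28 a k) {T : ℝ} (hT : 0 < T)
    (hper : ∀ k : Fin 28, ∃ z : ℤ, T * h28 a k = z) {F : Finset (Fin 28) → ℝ}
    (hF : ∀ A, F A = ∑ m ∈ Finset.range ((bkpts a T).card - 1), ((patternN a (bkpt a T m) A : ℤ) : ℝ))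
    {δ : Fin 8 → ℝ} (hconv : ∃ U ∈ 𝓝 δ, ConvexOn ℝ U (cuspSlope a T)) {δ₀ δ₀' : Fin 8 → ℝ}
    (hgen : ∀ k l : Fin 28, k ≠ l → phiForm δ₀ k / h28 a k ≠ phiForm δ₀ l / h28 a l)
    (hgen' : ∀ k l : Fin 28, k ≠ l → phiForm δ₀' k / h28 a k ≠ phiForm δ₀' l / h28 a l)
    (href : ∀ k l : Fin 28, phiForm δ k / h28 a k < phiForm δ l / h28 a l →
      phiForm δ₀ k / h28 a k < phiForm δ₀ l / h28 a l)
    (href' : ∀ k l : Fin 28, phiForm δ k / h28 a k < phiForm δ l / h28 a l →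
      phiForm δ₀' k / h28 a k < phiForm δ₀' l / h28 a l)
    {k l : Fin 28} (hkl : k ≠ l) (hρ : phiForm δ₀ l / h28 a l < phiForm δ₀ k / h28 a k)
    (hρ' : phiForm δ₀' k / h28 a k < phiForm δ₀' l / h28 a l)
    (hadj : ∀ j : Fin 28, ¬(phiForm δ₀ l / h28 a l < phiForm δ₀ j / h28 a j ∧
      phiForm δ₀ j / h28 a j < phiForm δ₀ k / h28 a k))
    (hside : ∀ j : Fin 28, j ≠ k → j ≠ l →
      (phiForm δ₀ k / h28 a k < phiForm δ₀ j / h28 a j ↔ phiForm δ₀' k / h28 a k < phiForm δ₀' j / h28 a j) ∧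
        (phiForm δ₀ l / h28 a l < phiForm δ₀ j / h28 a j ↔ phiForm δ₀' l / h28 a l < phiForm δ₀' j / h28 a j))
    (hsame : ∀ i j : Fin 28, i ≠ k → i ≠ l → j ≠ k → j ≠ l →
      (phiForm δ₀ i / h28 a i < phiForm δ₀ j / h28 a j ↔ phiForm δ₀' i / h28 a i < phiForm δ₀' j / h28 a j)) :
    0 ≤ F (insert k (Finset.univ.filter fun j => phiForm δ₀ k / h28 a k < phiForm δ₀ j / h28 a j)) +
        F (insert l (Finset.univ.filter fun j => phiForm δ₀ k / h28 a k < phiForm δ₀ j / h28 a j)) -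
        F (Finset.univ.filter fun j => phiForm δ₀ k / h28 a k < phiForm δ₀ j / h28 a j) -
        F (insert k (insert l (Finset.univ.filter fun j => phiForm δ₀ k / h28 a k < phiForm δ₀ j / h28 a j))) := by
  -- g30: at the direction `δ₀ − δ` the two functionals differ by the defect times the splitting
  have h := greedy_sub_greedy_of_adjacent (M := Finset.univ) F (ρ := fun j => phiForm δ₀ j / h28 a j)
    (ρ' := fun j => phiForm δ₀' j / h28 a j) (fun i _ j _ hij => hgen i j hij) (fun i _ j _ hij => hgen' i j hij)
    (Finset.mem_univ k) (Finset.mem_univ l) hkl hρ hρ' (fun j _ => hadj j) (fun j _ => hside j) (fun i _ j _ => hsame i j)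
    (fun j => phiForm (δ₀ - δ) j / h28 a j)
  beta_reduce at h
  -- file (1): `L_{δ₀'}(δ₀ − δ) ≤ L_{δ₀}(δ₀ − δ)`
  have hle := (convexOn_cuspSlope_nhds_iff hpos hT hper hF δ).mp hconv (δ₀ - δ) δ₀ δ₀' hgen hgen'
    (refines_lex_self_sub href) href'
  have hneg : phiForm (δ₀ - δ) l / h28 a l - phiForm (δ₀ - δ) k / h28 a k < 0 := by
    rw [rate_sub, rate_sub, rates_eq_of_refines_of_opposite href href' hρ hρ']
    linarith
  have hprod : (F (insert k (Finset.univ.filter fun j => phiForm δ₀ k / h28 a k < phiForm δ₀ j / h28 a j)) +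
      F (insert l (Finset.univ.filter fun j => phiForm δ₀ k / h28 a k < phiForm δ₀ j / h28 a j)) -
      F (Finset.univ.filter fun j => phiForm δ₀ k / h28 a k < phiForm δ₀ j / h28 a j) -
      F (insert k (insert l (Finset.univ.filter fun j => phiForm δ₀ k / h28 a k < phiForm δ₀ j / h28 a j)))) *
      (phiForm (δ₀ - δ) l / h28 a l - phiForm (δ₀ - δ) k / h28 a k) ≤ 0 := by
    rw [← h]; linarith
  by_contra hm
  have := mul_pos_of_neg_of_neg (not_le.mp hm) hneg
  linarith

/-- **WHERE `σ` IS LOCALLY CONCAVE, EVERY REALISED ADJACENT WALL DEFECT IS `≤ 0`** (the supermodular inequality at that wall;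
hypotheses as in `defect_nonneg_of_convexOn`). -/
theorem defect_nonpos_of_concaveOn {a : Dir} (hpos : ∀ k, 0 < h28 a k) {T : ℝ} (hT : 0 < T)
    (hper : ∀ k : Fin 28, ∃ z : ℤ, T * h28 a k = z) {F : Finset (Fin 28) → ℝ}
    (hF : ∀ A, F A = ∑ m ∈ Finset.range ((bkpts a T).card - 1), ((patternN a (bkpt a T m) A : ℤ) : ℝ))
    {δ : Fin 8 → ℝ} (hconc : ∃ U ∈ 𝓝 δ, ConcaveOn ℝ U (cuspSlope a T)) {δ₀ δ₀' : Fin 8 → ℝ}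
    (hgen : ∀ k l : Fin 28, k ≠ l → phiForm δ₀ k / h28 a k ≠ phiForm δ₀ l / h28 a l)
    (hgen' : ∀ k l : Fin 28, k ≠ l → phiForm δ₀' k / h28 a k ≠ phiForm δ₀' l / h28 a l)
    (href : ∀ k l : Fin 28, phiForm δ k / h28 a k < phiForm δ l / h28 a l →
      phiForm δ₀ k / h28 a k < phiForm δ₀ l / h28 a l)
    (href' : ∀ k l : Fin 28, phiForm δ k / h28 a k < phiForm δ l / h28 a l →
      phiForm δ₀' k / h28 a k < phiForm δ₀' l / h28 a l)
    {k l : Fin 28} (hkl : k ≠ l) (hρ : phiForm δ₀ l / h28 a l < phiForm δ₀ k / h28 a k)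
    (hρ' : phiForm δ₀' k / h28 a k < phiForm δ₀' l / h28 a l)
    (hadj : ∀ j : Fin 28, ¬(phiForm δ₀ l / h28 a l < phiForm δ₀ j / h28 a j ∧
      phiForm δ₀ j / h28 a j < phiForm δ₀ k / h28 a k))
    (hside : ∀ j : Fin 28, j ≠ k → j ≠ l →
      (phiForm δ₀ k / h28 a k < phiForm δ₀ j / h28 a j ↔ phiForm δ₀' k / h28 a k < phiForm δ₀' j / h28 a j) ∧
        (phiForm δ₀ l / h28 a l < phiForm δ₀ j / h28 a j ↔ phiForm δ₀' l / h28 a l < phiForm δ₀' j / h28 a j))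
    (hsame : ∀ i j : Fin 28, i ≠ k → i ≠ l → j ≠ k → j ≠ l →
      (phiForm δ₀ i / h28 a i < phiForm δ₀ j / h28 a j ↔ phiForm δ₀' i / h28 a i < phiForm δ₀' j / h28 a j)) :
    F (insert k (Finset.univ.filter fun j => phiForm δ₀ k / h28 a k < phiForm δ₀ j / h28 a j)) +
        F (insert l (Finset.univ.filter fun j => phiForm δ₀ k / h28 a k < phiForm δ₀ j / h28 a j)) -
        F (Finset.univ.filter fun j => phiForm δ₀ k / h28 a k < phiForm δ₀ j / h28 a j) -
        F (insert k (insert l (Finset.univ.filter fun j => phiForm δ₀ k / h28 a k < phiForm δ₀ j / h28 a j))) ≤ 0 := by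
  have h := greedy_sub_greedy_of_adjacent (M := Finset.univ) F (ρ := fun j => phiForm δ₀ j / h28 a j)
    (ρ' := fun j => phiForm δ₀' j / h28 a j) (fun i _ j _ hij => hgen i j hij) (fun i _ j _ hij => hgen' i j hij)
    (Finset.mem_univ k) (Finset.mem_univ l) hkl hρ hρ' (fun j _ => hadj j) (fun j _ => hside j) (fun i _ j _ => hsame i j)
    (fun j => phiForm (δ₀ - δ) j / h28 a j)
  beta_reduce at h
  have hge := (concaveOn_cuspSlope_nhds_iff hpos hT hper hF δ).mp hconc (δ₀ - δ) δ₀ δ₀' hgen hgen'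
    (refines_lex_self_sub href) href'
  have hneg : phiForm (δ₀ - δ) l / h28 a l - phiForm (δ₀ - δ) k / h28 a k < 0 := by
    rw [rate_sub, rate_sub, rates_eq_of_refines_of_opposite href href' hρ hρ']
    linarith
  have hprod : 0 ≤ (F (insert k (Finset.univ.filter fun j => phiForm δ₀ k / h28 a k < phiForm δ₀ j / h28 a j)) +
      F (insert l (Finset.univ.filter fun j => phiForm δ₀ k / h28 a k < phiForm δ₀ j / h28 a j)) -
      F (Finset.univ.filter fun j => phiForm δ₀ k / h28 a k < phiForm δ₀ j / h28 a j) -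
      F (insert k (insert l (Finset.univ.filter fun j => phiForm δ₀ k / h28 a k < phiForm δ₀ j / h28 a j)))) *
      (phiForm (δ₀ - δ) l / h28 a l - phiForm (δ₀ - δ) k / h28 a k) := by
    rw [← h]; linarith
  by_contra hm
  have := mul_neg_of_pos_of_neg (not_le.mp hm) hneg
  linarith

end Summit.KontsevichZagierPeriods.Zeta5Search.Barrier.ConeGamma

end
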